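import Summits.QuantumFields.BalabanUV.Beta.EriceFlowEnclosureB12AsPrintedHistoryContagionProfile

/-!
# Beta / EriceFlowEnclosureB12AsPrintedHistoryContagionEnd — ASYMPTOTIC FREEDOM IS CONTAGIOUS, part 3 (carrier and ENDs): in a box of ANY size
# carrying coupling-chart history moduli with fading memory, [I] THEOREM 2 AS TYPED supplies ONE reference row, and then (i) «g₀ = g₀(ε, g)» is
# UNIQUE among ALL in-box rows ending at a small coupling (no confinement of the comparison rows, no box-versus-modulus smallness), and
# (ii) EVERY in-box row ending at a small g — in particular Theorem 2's own rows at every small endpoint — carries the printed two-sided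
# logarithmic running (0.31) with ONE pair of constants up to an END-ANCHORED defect: the TYPED reading (β, β′ after g) implies the UNIFORM
# reading away from the last O(1∕(βg²)) scales (β-flow team, prover 1 = recursion ∕ upper ∕ bare-coupling ∕ UNIQUENESS side, unit
# `b2b-balaban-beta-bflow-p1`, gen 35; ROW AP-I·U, fourth reading; parts 1∕2 `…HistoryContagion` ∕ `…HistoryContagionProfile`; part 4
# `…HistoryContagionSharp` = the two load-bearing inputs (θ < 1; the reference row); sibling: prover 2's gen 44 `…PointwiseFadingOrder` (tree
# 22:34Z the same day) = reference-free, sign-free uniqueness and the typed-∃! END by the FORWARD ORDER argument in a SMALL box `4Cγ³ ≤ (1 − θ)²`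
# — the typed-∃! END is THEIRS and is not restated here)

HONEST FRAMING (page 1 of everything the β sub-cell writes): discharging `BetaPertH` makes Bałaban's UV stability UNCONDITIONAL — a
real constructive-QFT result; it is NOT the continuum limit and NOT the Clay problem.  HONEST DEPENDENCY (cell reorg 2026-08-19,
verbatim): «continuum YM on T⁴ ⇐ BetaPertH ∧ nine spine estimates (0/9 proved); BetaPertH ⇐ (D1) ∧ (D4) ∧ CAP+tail; G-an2-4 gates
asym, D1 and NE2/3/4.»  THIS MODULE DISCHARGES NOTHING: bookkeeping from the NAMED FIELDS of the statement-exact typing of [I] =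
T. Bałaban, Commun. Math. Phys. **109** (1987) [Balaban1987RG1] (`B12BetaAsPrinted`: `Definitions.d018`, `Theorem2Statement` — Theorem 2 is STATED
WITHOUT PROOF, p. 259; [Balaban1989LargeFieldII] p. 355 *"has not been published yet"* — in its TYPED quantifier order `Missing.B12Thm2Shape`:
∀ m ∃ γ₀ ∀ γ ∃ g₁ ∀ g ∃ β β′ ∀ K ∃ g₀, the constants of (0.31) chosen AFTER g), prover 1's binder `hrg` (in-interval rows obey (0.20)) and node U2's
HYPOTHESIS SHAPES `T4CouplingMatching.HistLipschitz ∕ FadingMemory` (NOT printed: [I] p. 298 says only that β_j *"depends also on all preceding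
coupling constants"*).  Every letter is a hypothesis on an abstract `Setting`; nothing of Bałaban's β is asserted.

THE POINT.  Part 2 turns ONE run carrying (0.31)'s lower half from its end into confinement (A ≤ 2A_K), a quarter-rate AF profile, (0.31)'s upper
half (given the reference's) and pinned uniqueness for EVERY same-depth run in the box ending at a small coupling — with no AF letter, no sign,
no upper letter, and NO smallness of the box γ against the modulus (C, θ).  Theorem 2 AS TYPED, read at ONE admissible endpoint g₁, IS such a
reference at every depth K.  Hence on the carrier: (§6) **`theorem2_unique_bigBox_typed`** — `Theorem2Statement` + `Definitions` + `hrg` and the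
moduli on ]0, γ_u] ⟹ for every m some g₂ > 0 such that ANY two rows (K, m, g₀), (K, m, g₀′) lying in the WHOLE box ]0, γ_u] with the same
endpoint ≤ g₂ have g₀ = g₀′ (prover 2's gen-43∕44 local uniqueness confines the comparison rows to ]0, g₂] with g₂ small against (b, C, θ) resp.
`4Cg₂³ ≤ (1 − θ)²`; here γ_u is arbitrary — part 4's Markov fold shows why a reference is then indispensable); and (§7)
**`uniform031_defected_of_typedTheorem2`** — the same data give ONE pair (β_u, β′_u) and g₂ > 0 such that EVERY row in ]0, γ_u] of any depth K ending at
e ≤ g₂ satisfies `1∕(4e²) + β_u(K − k) ≤ 1∕g_k² ≤ 7∕(4e²) + β′_u(K − k)` (k ≤ K): the printed (0.31) with g-UNIFORM constants and an end-anchored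
defect 3∕(4e²) on either side.  So, under fading memory in the coupling chart, the placement of «there exist constants β, β′» after «for g» (p. 259
as typed) can matter only on the last O(1∕(β_u e²)) scales of a row; prover 2's `…PointwiseSizeWitness.typed_theorem2_not_uniform` (#59e, a Markov
toy) shows it does matter there.

WHAT THIS FILE PROVES (0 sorry, 0 def):
§5 `bareCoupling_unique_of_reference` (carrier: two rows in ]0, γ] with the same small endpoint and ONE reference row (any m′) ⟹ g₀ = g₀′).
§6 **`localUnique_bigBox_of_reference`** (from reference rows at one endpoint: uniqueness among ALL rows in ]0, γ] ending below g₂),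
   **`theorem2_unique_bigBox_typed`** (from `Theorem2Statement` AS TYPED).
§7 **`uniform031_defected_of_reference`**, **`uniform031_defected_of_typedTheorem2`** (TYPED ⟹ UNIFORM up to the end-anchored defect, along
   every in-box row ending below g₂, with no (U) letter).
NOT CLAIMED: any modulus, sign or bound for Bałaban's β; which reading print intends; Theorem 2; `BetaPertH`; continuum; Clay.
-/

namespace Summit.QuantumFields.BalabanUV.Beta.EriceFlowEnclosureB12AsPrintedHistoryContagionEnd

open Finset
open Literature.MathematicalPhysics.QuantumFieldTheory.Balaban1983to89
open Literature.MathematicalPhysics.QuantumFieldTheory.Balaban1983to89.B12BetaAsPrinted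
open Literature.MathematicalPhysics.QuantumFieldTheory.Balaban1983to89.FlowStep (prefixOf Box mem_box box_mono RGEqH BetaUpperH)
open Literature.MathematicalPhysics.QuantumFieldTheory.Balaban1983to89.T4CouplingMatching (HistLipschitz FadingMemory)
open Summit.QuantumFields.BalabanUV.Beta.EriceFlowEnclosureB12AsPrintedUpper (tunedRuns_of_theorem2Statement)
open Summit.QuantumFields.BalabanUV.Beta.EriceFlowEnclosureB12AsPrintedHistoryContagionProfile (inv_sq_lower_of_reference
  inv_sq_upper_of_reference runs_eq_of_reference_fadingMemory threshold_exists)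

noncomputable section

variable {S : Setting}

/-! ## §5 On the carrier: one reference row makes the bare coupling of a small-endpoint row unique -/

/-- **«g₀(ε, g)» IS A FUNCTION NEAR ZERO, GIVEN ONE REFERENCE ROW.**  For a setting with the printed `Definitions` ((0.18): rows start at their bare
coupling): two rows (K, m, g₀), (K, m, g₀′) obeying (0.20), staying in ]0, γ] and ending at the same g_K, and ONE reference row (K, m′, t₀) in ]0, γ]
obeying (0.20) and (0.31)'s lower half from its end at rate β* > 0; moduli `HistLipschitz Λ γ S.β`, `FadingMemory C θ Λ` (0 < θ < 1); the common
endpoint below the threshold of part 2 (`4C·g_K ≤ β*(1 − θ)`, `g_K²·Q ≤ 3∕4`, `C(8g_K³ + 16g_K∕β*) ≤ (1 − θ)∕2`).  Then g₀ = g₀′ and the rows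
coincide at every scale.  No AF letter, no sign letter, no smallness of γ against (C, θ). [cite: Balaban1987RG1, Thm 2 p.259 («g₀ = g₀(ε, g)») with (0.18)–(0.20) pp.255–256 and p.298] -/
theorem bareCoupling_unique_of_reference (hD : Definitions S) {γ θ C bs : ℝ} {Λ : ℕ → ℕ → ℝ}
    (hθ0 : 0 < θ) (hθ1 : θ < 1) (hC : 0 ≤ C) (hbs : 0 < bs)
    (hL : HistLipschitz Λ γ S.β) (hΛ : FadingMemory C θ Λ) {K m m' : ℕ} {g₀ g₀' t₀ : ℝ}
    (hrg : RGEqH K S.β (S.cpl ⟨K, m, g₀⟩)) (hrg' : RGEqH K S.β (S.cpl ⟨K, m, g₀'⟩)) (hrgt : RGEqH K S.β (S.cpl ⟨K, m', t₀⟩))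
    (hI : Step.InInterval γ K (S.cpl ⟨K, m, g₀⟩)) (hI' : Step.InInterval γ K (S.cpl ⟨K, m, g₀'⟩))
    (hIt : Step.InInterval γ K (S.cpl ⟨K, m', t₀⟩)) (hpin : S.cpl ⟨K, m, g₀⟩ K = S.cpl ⟨K, m, g₀'⟩ K)
    (h031 : ∀ i, i ≤ K → 1 / (S.cpl ⟨K, m', t₀⟩ K) ^ 2 + bs * ((K : ℝ) - i) ≤ 1 / (S.cpl ⟨K, m', t₀⟩ i) ^ 2)
    (hs1 : 4 * C * S.cpl ⟨K, m, g₀⟩ K ≤ bs * (1 - θ))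
    (hs2 : (S.cpl ⟨K, m, g₀⟩ K) ^ 2 * (C * γ / (1 - θ) ^ 2 + C / (1 - θ) * S.cpl ⟨K, m', t₀⟩ K
      + (2 * C / ((1 - θ) * bs)) ^ 2 + 1 / (4 * (S.cpl ⟨K, m', t₀⟩ K) ^ 2)) ≤ 3 / 4)
    (hs3 : C * (8 * (S.cpl ⟨K, m, g₀⟩ K) ^ 3 + 16 * S.cpl ⟨K, m, g₀⟩ K / bs) ≤ (1 - θ) / 2) :
    g₀ = g₀' ∧ ∀ j, j ≤ K → S.cpl ⟨K, m, g₀⟩ j = S.cpl ⟨K, m, g₀'⟩ j := by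
  have hall := runs_eq_of_reference_fadingMemory hθ0 hθ1 hC hbs hL hΛ hrg hrg' hrgt hI hI' hIt hpin h031 hs1 hs2 hs3
  refine ⟨?_, hall⟩
  have h0 := hall 0 (Nat.zero_le K)
  rwa [hD.d018, hD.d018] at h0

/-! ## §6 Uniqueness among ALL rows of the box, from reference rows at one endpoint ∕ from Theorem 2 as typed -/

/-- **LOCAL UNIQUENESS NEAR ZERO AMONG ALL ROWS OF THE BOX.**  Data: reference rows (K, m′, t₀) at EVERY depth K, inside ]0, γ], ending at ONE endpoint
g₁ and carrying (0.31)'s lower half from it at rate b > 0 (`hT` — what Theorem 2 AS TYPED gives at the single endpoint g₁); the binder `hrg` and the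
moduli `HistLipschitz Λ γ S.β`, `FadingMemory C θ Λ` (0 < θ < 1) on ]0, γ]; the printed `Definitions`.  Then there is g₂ > 0 such that two rows
(K, m, g₀), (K, m, g₀′) lying ANYWHERE in ]0, γ] with the same endpoint ≤ g₂ have g₀ = g₀′.  The box γ is NOT assumed small against (C, θ) or b:
compare prover 2's `…PointwiseFading.localUnique_of_fadingMemory` (gen 43: rows in ]0, g₂], `g₂C∕(1 − θ) ≤ b∕2`, g-uniform rate) and
`…PointwiseFadingOrder.localUnique_signFree` (gen 44: rows in ]0, g₂], `4Cg₂³ ≤ (1 − θ)²`, no reference). [cite: Balaban1987RG1, Thm 2 p.259 («g₀ = g₀(ε, g)») with (0.18)–(0.20) pp.255–256 and p.298] -/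
theorem localUnique_bigBox_of_reference (hD : Definitions S) {m m' : ℕ} {γ g₁ b θ C : ℝ} {Λ : ℕ → ℕ → ℝ}
    (hθ0 : 0 < θ) (hθ1 : θ < 1) (hC : 0 ≤ C) (hb : 0 < b)
    (hrg : ∀ P : B12.RunParams, Step.InInterval γ P.K (S.cpl P) → RGEqH P.K S.β (S.cpl P))
    (hL : HistLipschitz Λ γ S.β) (hΛ : FadingMemory C θ Λ)
    (hT : ∀ K : ℕ, ∃ t₀ : ℝ, Step.InInterval γ K (S.cpl ⟨K, m', t₀⟩) ∧ S.cpl ⟨K, m', t₀⟩ K = g₁ ∧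
      ∀ i, i ≤ K → 1 / g₁ ^ 2 + b * ((K : ℝ) - i) ≤ 1 / (S.cpl ⟨K, m', t₀⟩ i) ^ 2) :
    ∃ g₂ : ℝ, 0 < g₂ ∧ ∀ (K : ℕ) (g₀ g₀' : ℝ), Step.InInterval γ K (S.cpl ⟨K, m, g₀⟩) →
      Step.InInterval γ K (S.cpl ⟨K, m, g₀'⟩) → S.cpl ⟨K, m, g₀⟩ K = S.cpl ⟨K, m, g₀'⟩ K → S.cpl ⟨K, m, g₀⟩ K ≤ g₂ → g₀ = g₀' := by
  obtain ⟨e₀, he₀, hthr⟩ := threshold_exists (γ := γ) g₁ hθ1 hC hb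
  refine ⟨e₀, he₀, fun K g₀ g₀' hI hI' hpin hle => ?_⟩
  obtain ⟨t₀, hIt, hendt, h031t⟩ := hT K
  have h031 : ∀ i, i ≤ K → 1 / (S.cpl ⟨K, m', t₀⟩ K) ^ 2 + b * ((K : ℝ) - i) ≤ 1 / (S.cpl ⟨K, m', t₀⟩ i) ^ 2 := by
    intro i hi
    rw [hendt]
    exact h031t i hi
  obtain ⟨hs1, hs2, hs3⟩ := hthr (S.cpl ⟨K, m, g₀⟩ K) (hI K le_rfl).1 hle
  rw [← hendt] at hs2
  exact (bareCoupling_unique_of_reference hD hθ0 hθ1 hC hb hL hΛ (hrg ⟨K, m, g₀⟩ hI) (hrg ⟨K, m, g₀'⟩ hI') (hrg ⟨K, m', t₀⟩ hIt)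
    hI hI' hIt hpin h031 hs1 hs2 hs3).1

/-- **«g₀ = g₀(ε, g)» IS UNIQUE AMONG ALL ROWS OF THE BOX, FROM THEOREM 2 AS TYPED.**  `Theorem2Statement S hL` ([I] Theorem 2 AS TYPED, `Missing.B12Thm2Shape` —
a HYPOTHESIS, stated without proof in print), the printed `Definitions`, the binder `hrg` on a box ]0, γ_u] and `HistLipschitz Λ γ_u S.β` with
`FadingMemory C θ Λ` (0 < θ < 1, C ≥ 0) ⟹ for every m there is g₂ > 0 such that ANY two rows (K, m, g₀), (K, m, g₀′) lying in the WHOLE box ]0, γ_u]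
with the same endpoint ≤ g₂ have g₀ = g₀′.  Proof: Theorem 2 at the box min γ₀ γ_u and its endpoint g₁ gives, at every depth, a reference row inside
]0, γ_u] with (0.31)'s lower half at rate β(g₁) ln L; `localUnique_bigBox_of_reference`.  γ_u is ARBITRARY against (C, θ): the contagion confines every
small-endpoint row below twice its endpoint.  (Existence of a row ending at each small g is Theorem 2's; the typed ∃! in a small box is prover 2's
gen-44 `theorem2_existsUnique_of_fadingMemory_signFree`, not restated.) [cite: Balaban1987RG1, Thm 2 (0.31) p.259 with (0.18)–(0.20) pp.255–256 and p.298] -/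
theorem theorem2_unique_bigBox_typed {hL : Odd S.L ∧ 1 < S.L} (h : Theorem2Statement S hL) (hD : Definitions S)
    {γu θ C : ℝ} {Λ : ℕ → ℕ → ℝ} (hγu : 0 < γu)
    (hrg : ∀ P : B12.RunParams, Step.InInterval γu P.K (S.cpl P) → RGEqH P.K S.β (S.cpl P))
    (hL' : HistLipschitz Λ γu S.β) (hΛ : FadingMemory C θ Λ) (hθ0 : 0 < θ) (hθ1 : θ < 1) (hC : 0 ≤ C) (m : ℕ) :
    ∃ g₂ : ℝ, 0 < g₂ ∧ ∀ (K : ℕ) (g₀ g₀' : ℝ), Step.InInterval γu K (S.cpl ⟨K, m, g₀⟩) →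
      Step.InInterval γu K (S.cpl ⟨K, m, g₀'⟩) → S.cpl ⟨K, m, g₀⟩ K = S.cpl ⟨K, m, g₀'⟩ K → S.cpl ⟨K, m, g₀⟩ K ≤ g₂ → g₀ = g₀' := by
  obtain ⟨γ₀, hγ₀, hγ⟩ := tunedRuns_of_theorem2Statement h m
  obtain ⟨g₁, hg₁, hg⟩ := hγ (min γ₀ γu) (lt_min hγ₀ hγu) (min_le_left _ _)
  obtain ⟨β, β', hβ, -, hT⟩ := hg g₁ hg₁ le_rfl
  have hbs : 0 < β * Real.log S.L := mul_pos hβ (Real.log_pos (by exact_mod_cast hL.2))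
  refine localUnique_bigBox_of_reference (m' := m) (g₁ := g₁) hD hθ0 hθ1 hC hbs hrg hL' hΛ fun K => ?_
  obtain ⟨t₀, hIt, hendt, h031t⟩ := hT K
  exact ⟨t₀, fun i hi => ⟨(hIt i hi).1, (hIt i hi).2.trans (min_le_right _ _)⟩, hendt, fun i hi => (h031t i hi).1⟩

/-! ## §7 The typed reading implies the uniform reading up to an end-anchored defect -/

/-- **(0.31) WITH UNIFORM CONSTANTS AND AN END-ANCHORED DEFECT, ALONG EVERY ROW OF THE BOX ENDING BELOW g₂ — from reference rows at one endpoint.**  Data: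
reference rows at every depth inside ]0, γ] ending at g₁ with the TWO-SIDED (0.31) `Step.Discrete031 b b′` (b > 0); `hrg` and the moduli on ]0, γ].  Then
there is g₂ > 0 such that EVERY row P lying in ]0, γ] with endpoint e = g_{P.K} ≤ g₂ satisfies, for all k ≤ P.K,
`1∕(4e²) + (b∕4)(K − k) ≤ 1∕g_k² ≤ 7∕(4e²) + (b′ + 3b∕4)(K − k)` — parts 2's `inv_sq_lower_of_reference` ∕ `inv_sq_upper_of_reference`; no (U) letter, no
sign, no AF letter, γ arbitrary against (C, θ). [cite: Balaban1987RG1, Thm 2 (0.31) p.259 with (0.20) p.256 and p.298] -/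
theorem uniform031_defected_of_reference {m' : ℕ} {γ g₁ b b' θ C : ℝ} {Λ : ℕ → ℕ → ℝ}
    (hθ0 : 0 ≤ θ) (hθ1 : θ < 1) (hC : 0 ≤ C) (hb : 0 < b)
    (hrg : ∀ P : B12.RunParams, Step.InInterval γ P.K (S.cpl P) → RGEqH P.K S.β (S.cpl P))
    (hL : HistLipschitz Λ γ S.β) (hΛ : FadingMemory C θ Λ)
    (hT : ∀ K : ℕ, ∃ t₀ : ℝ, Step.InInterval γ K (S.cpl ⟨K, m', t₀⟩) ∧ S.cpl ⟨K, m', t₀⟩ K = g₁ ∧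
      Step.Discrete031 b b' K g₁ (S.cpl ⟨K, m', t₀⟩)) :
    ∃ g₂ : ℝ, 0 < g₂ ∧ ∀ P : B12.RunParams, Step.InInterval γ P.K (S.cpl P) → S.cpl P P.K ≤ g₂ → ∀ k, k ≤ P.K →
      1 / (4 * (S.cpl P P.K) ^ 2) + b / 4 * ((P.K : ℝ) - k) ≤ 1 / (S.cpl P k) ^ 2 ∧
      1 / (S.cpl P k) ^ 2 ≤ 7 / (4 * (S.cpl P P.K) ^ 2) + (b' + 3 * b / 4) * ((P.K : ℝ) - k) := by
  obtain ⟨e₀, he₀, hthr⟩ := threshold_exists (γ := γ) g₁ hθ1 hC hb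
  refine ⟨e₀, he₀, fun P hI hle k hk => ?_⟩
  obtain ⟨t₀, hIt, hendt, h031t⟩ := hT P.K
  have h031 : ∀ i, i ≤ P.K → 1 / (S.cpl ⟨P.K, m', t₀⟩ P.K) ^ 2 + b * ((P.K : ℝ) - i) ≤ 1 / (S.cpl ⟨P.K, m', t₀⟩ i) ^ 2 := by
    intro i hi
    rw [hendt]
    exact (h031t i hi).1
  have h031' : ∀ i, i ≤ P.K → 1 / (S.cpl ⟨P.K, m', t₀⟩ i) ^ 2 ≤ 1 / (S.cpl ⟨P.K, m', t₀⟩ P.K) ^ 2 + b' * ((P.K : ℝ) - i) := by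
    intro i hi
    rw [hendt]
    exact (h031t i hi).2
  obtain ⟨hs1, hs2, -⟩ := hthr (S.cpl P P.K) (hI P.K le_rfl).1 hle
  rw [← hendt] at hs2
  exact ⟨inv_sq_lower_of_reference hθ0 hθ1 hC hb hL hΛ (hrg P hI) (hrg ⟨P.K, m', t₀⟩ hIt) hI hIt h031 hs1 hs2 k hk,
    inv_sq_upper_of_reference hθ0 hθ1 hC hb hL hΛ (hrg P hI) (hrg ⟨P.K, m', t₀⟩ hIt) hI hIt h031 h031' hs1 hs2 k hk⟩

/-- **TYPED ⟹ UNIFORM UP TO THE END-ANCHORED DEFECT.**  `Theorem2Statement S hL` AS TYPED (constants of (0.31) chosen AFTER g), the binder `hrg` on ]0, γ_u] and the moduli `HistLipschitz Λ γ_u S.β`, `FadingMemory C θ Λ` (0 ≤ θ < 1, C ≥ 0) ⟹ for every m there are ONE PAIR of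
constants 0 < β_u ≤ β′_u and g₂ > 0 such that EVERY row P lying in ]0, γ_u] — whatever its depth, bare end and m, in particular Theorem 2's own row
at every endpoint ≤ g₂ — with endpoint e = g_{P.K} ≤ g₂ satisfies, for all k ≤ P.K,
**`1∕(4e²) + β_u(K − k) ≤ 1∕g_k² ≤ 7∕(4e²) + β′_u(K − k)`**: the printed (0.31) with g-UNIFORM constants (β_u = β(g₁) ln L∕4, β′_u = β′(g₁) ln L +
3β(g₁) ln L∕4 for ONE admissible endpoint g₁) and an end-anchored defect 3∕(4e²) on either side — i.e. the literal lower half `1∕e² + (β_u∕2)(K − k) ≤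
1∕g_k²` at every scale with `(β_u∕2)(K − k) ≥ 3∕(4e²)`.  Under fading memory the typed placement of «there exist constants β, β′» can matter only on
the last O(1∕(β_u e²)) scales (prover 2's #59e shows it does matter there, for SIZE). [cite: Balaban1987RG1, Thm 2 (0.31) p.259 with (0.20) p.256 and p.298] -/
theorem uniform031_defected_of_typedTheorem2 {hL : Odd S.L ∧ 1 < S.L} (h : Theorem2Statement S hL)
    {γu θ C : ℝ} {Λ : ℕ → ℕ → ℝ} (hγu : 0 < γu)
    (hrg : ∀ P : B12.RunParams, Step.InInterval γu P.K (S.cpl P) → RGEqH P.K S.β (S.cpl P))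
    (hL' : HistLipschitz Λ γu S.β) (hΛ : FadingMemory C θ Λ) (hθ0 : 0 ≤ θ) (hθ1 : θ < 1) (hC : 0 ≤ C) (m : ℕ) :
    ∃ βu βu' g₂ : ℝ, 0 < βu ∧ βu ≤ βu' ∧ 0 < g₂ ∧
      ∀ P : B12.RunParams, Step.InInterval γu P.K (S.cpl P) → S.cpl P P.K ≤ g₂ → ∀ k, k ≤ P.K →
        1 / (4 * (S.cpl P P.K) ^ 2) + βu * ((P.K : ℝ) - k) ≤ 1 / (S.cpl P k) ^ 2 ∧
        1 / (S.cpl P k) ^ 2 ≤ 7 / (4 * (S.cpl P P.K) ^ 2) + βu' * ((P.K : ℝ) - k) := by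
  obtain ⟨γ₀, hγ₀, hγ⟩ := tunedRuns_of_theorem2Statement h m
  obtain ⟨g₁, hg₁, hg⟩ := hγ (min γ₀ γu) (lt_min hγ₀ hγu) (min_le_left _ _)
  obtain ⟨β, β', hβ, hββ', hT⟩ := hg g₁ hg₁ le_rfl
  have hlog : 0 < Real.log S.L := Real.log_pos (by exact_mod_cast hL.2)
  have hbs : 0 < β * Real.log S.L := mul_pos hβ hlog
  have hT' : ∀ K : ℕ, ∃ t₀ : ℝ, Step.InInterval γu K (S.cpl ⟨K, m, t₀⟩) ∧ S.cpl ⟨K, m, t₀⟩ K = g₁ ∧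
      Step.Discrete031 (β * Real.log S.L) (β' * Real.log S.L) K g₁ (S.cpl ⟨K, m, t₀⟩) := by
    intro K
    obtain ⟨t₀, hIt, hendt, h031t⟩ := hT K
    exact ⟨t₀, fun i hi => ⟨(hIt i hi).1, (hIt i hi).2.trans (min_le_right _ _)⟩, hendt, h031t⟩
  obtain ⟨g₂, hg₂, hP⟩ := uniform031_defected_of_reference hθ0 hθ1 hC hbs hrg hL' hΛ hT'
  refine ⟨β * Real.log S.L / 4, β' * Real.log S.L + 3 * (β * Real.log S.L) / 4, g₂, by positivity, ?_, hg₂, fun P hI hle k hk => ?_⟩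
  · have : 0 ≤ β' * Real.log S.L := mul_nonneg (hβ.le.trans hββ') hlog.le
    linarith
  · have h1 := hP P hI hle k hk
    constructor
    · linarith [h1.1]
    · linarith [h1.2]

end

end Summit.QuantumFields.BalabanUV.Beta.EriceFlowEnclosureB12AsPrintedHistoryContagionEnd
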